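import Summits.ValiantsHypothesis.ValiantsHypothesis.Theorems.LacunarySymmetroidMatrixDescartesCensusChamberLambdaCell

/-!
# `MatrixDescartes` census — the INTERVAL MODEL of the `(2,K)` sign layer and the Π-row (transitivity of «far»)

HONEST FRAMING.  Object-search cell `pub-symmetroid`, door-A target `DoorA26 := PosRootLawAt 2 6 19`
(stmt-ValiantsHypothesis-19979; OPEN, typed, never asserted), crux `Theses.LacunarySymmetroid.MatrixDescartes`
(stmt-ValiantsHypothesis-18050).  A letter `[[a,b],[b,c]]` is the binary form `a s² + 2b st + c t²`; with `W_ij = aᵢbⱼ − aⱼbᵢ`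
and `D = b² − ac` one has `aᵢaⱼ·β(Sᵢ,Sⱼ) = W_ij² − aⱼ²Dᵢ − aᵢ²Dⱼ` (`interval_identity`), i.e. in the chart `u = −b/a`,
`h² = D/a²`: `β = aᵢaⱼ((uᵢ−uⱼ)² − hᵢ² − hⱼ²)` — two letters are «far» (`aᵢaⱼβ > 0`) iff their centres are more than
`√(hᵢ²+hⱼ²)` apart.  Consequences typed here (all elementary, polynomial):

* `pi_row_core` / `pi_row` — **Π-ROW**: if `j` is indefinite (`Dⱼ ≥ 0`), `far(i,j)`, `far(j,k)` and `near(i,k)`, then the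
  centre `uⱼ` lies strictly OUTSIDE `[uᵢ,u_k]` (`(uⱼ−uᵢ)(uⱼ−u_k) > 0`): «far» is transitive along the centre order through
  an indefinite middle letter, so for all-indefinite families the near-graph is a co-comparability graph in every chart;
* `shear_polarDet`, `shear_disc`, `exists_good_shear` — the chart can be moved by the shear `M = [[1,μ],[0,1]]` (pairings
  and `D` invariant), and some `μ` makes all six leading coefficients non-zero (pigeonhole over `μ = 0,…,12`).

Used by `…CensusChamberPi920*.lean` to kill the last sign-open mirror pair 920 / 1844 (word `IIIIII`) of the atlas.
SIGN layer only; nothing on `DoorA26` as a whole (OPEN), the crux, or `VP ≠ VNP`.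

[folklore] Elementary algebra of binary quadratic forms; the Π-row and its use are this seat's (method note
HOME/val-sym-door-p2/g2/PI-RULE-AND-INTERVAL-MODEL.md).
-/

-- `Summit.ValiantsHypothesis.ValiantsHypothesis.…` repeats a component by the D-0017 layout
-- (single-conjunct summit), which the `dupNamespace` linter flags; the name is mandated.
set_option linter.dupNamespace false

namespace Summit.ValiantsHypothesis.ValiantsHypothesis.Theorems.LacunarySymmetroidMatrixDescartes.Census

open Polynomial Finset
open scoped BigOperators Polynomial Matrix

/-- **Interval-model identity.**  For letters `[[aᵢ,bᵢ],[bᵢ,cᵢ]]`, `[[aⱼ,bⱼ],[bⱼ,cⱼ]]` (binary forms `a s² + 2b st + c t²`) with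
`W = aᵢbⱼ − aⱼbᵢ` and `D = b² − ac` (minus the determinant): `aᵢaⱼ·β(Sᵢ,Sⱼ) = W² − aⱼ²Dᵢ − aᵢ²Dⱼ`; in the chart `u = −b/a`,
`h² = D/a²` this reads `β = aᵢaⱼ((uᵢ−uⱼ)² − hᵢ² − hⱼ²)` («far» iff the centres are more than `√(hᵢ²+hⱼ²)` apart). [folklore] -/
theorem interval_identity (ai bi ci aj bj cj : ℝ) :
    ai * aj * (ai * cj + ci * aj - 2 * (bi * bj))
      = (ai * bj - aj * bi) ^ 2 - aj ^ 2 * (bi ^ 2 - ai * ci) - ai ^ 2 * (bj ^ 2 - aj * cj) := by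
  ring

/-- Cocycle of the centre differences: `aⱼ W_ik = aᵢ W_jk + a_k W_ij`. [folklore] -/
theorem interval_cocycle (ai bi aj bj ak bk : ℝ) :
    aj * (ai * bk - ak * bi) = ai * (aj * bk - ak * bj) + ak * (ai * bj - aj * bi) := by
  ring

/-- **Π-row, opaque form.**  If `far(i,j)`, `far(j,k)` (positive interval quantities), `near(i,k)`, the middle letter is
indefinite (`0 ≤ Dⱼ`) and `aⱼ ≠ 0`, then `uⱼ` lies strictly outside `[uᵢ,u_k]`: `aᵢ a_k W_ij W_jk < 0`. [folklore] -/
theorem pi_row_core {ai aj ak Wij Wjk Wik Di Dj Dk : ℝ} (haj : aj ≠ 0) (hDj : 0 ≤ Dj)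
    (hcoc : aj * Wik = ai * Wjk + ak * Wij)
    (hij : 0 < Wij ^ 2 - aj ^ 2 * Di - ai ^ 2 * Dj) (hjk : 0 < Wjk ^ 2 - ak ^ 2 * Dj - aj ^ 2 * Dk)
    (hik : Wik ^ 2 - ak ^ 2 * Di - ai ^ 2 * Dk < 0) : ai * ak * (Wij * Wjk) < 0 := by
  by_contra h0'
  have h0 : 0 ≤ ai * ak * (Wij * Wjk) := not_lt.mp h0'
  have haj2 : 0 < aj ^ 2 := by positivity
  have h1 : ai ^ 2 * Wjk ^ 2 + ak ^ 2 * Wij ^ 2 ≤ (aj * Wik) ^ 2 := by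
    rw [hcoc]; nlinarith
  have h2 : aj ^ 2 * (ak ^ 2 * Di + ai ^ 2 * Dk) < ai ^ 2 * Wjk ^ 2 + ak ^ 2 * Wij ^ 2 := by
    nlinarith [mul_nonneg (sq_nonneg ai) hij.le, mul_nonneg (sq_nonneg ak) hjk.le, sq_nonneg ai, sq_nonneg ak,
      mul_nonneg (mul_nonneg (sq_nonneg ai) (sq_nonneg ak)) hDj]
  have h3 : aj ^ 2 * (Wik ^ 2 - ak ^ 2 * Di - ai ^ 2 * Dk) < 0 := by nlinarith
  have h4 : aj ^ 2 * (ak ^ 2 * Di + ai ^ 2 * Dk) < aj ^ 2 * Wik ^ 2 := by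
    have := mul_pow aj Wik 2; nlinarith
  nlinarith

/-- **Π-ROW** in letter coordinates: for letters `i, j, k` with `aᵢ, aⱼ, a_k ≠ 0`, `j` indefinite, `far(i,j)`, `far(j,k)`
(`a a β > 0`) and `near(i,k)` (`a a β < 0`), the centres `u = −b/a` satisfy `(uⱼ − uᵢ)(uⱼ − u_k) > 0`. [folklore] -/
theorem pi_row (ai bi ci aj bj cj ak bk ck : ℝ) (hai : ai ≠ 0) (haj : aj ≠ 0) (hak : ak ≠ 0)
    (hDj : 0 ≤ bj ^ 2 - aj * cj)
    (hij : 0 < ai * aj * (ai * cj + ci * aj - 2 * (bi * bj))) (hjk : 0 < aj * ak * (aj * ck + cj * ak - 2 * (bj * bk)))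
    (hik : ai * ak * (ai * ck + ci * ak - 2 * (bi * bk)) < 0) :
    0 < (-bj / aj - -bi / ai) * (-bj / aj - -bk / ak) := by
  have r := pi_row_core (Di := bi ^ 2 - ai * ci) (Dk := bk ^ 2 - ak * ck) haj hDj (interval_cocycle ai bi aj bj ak bk)
    (by rw [← interval_identity]; exact hij) (by rw [← interval_identity]; exact hjk)
    (by rw [← interval_identity]; exact hik)
  have e : (-bj / aj - -bi / ai) * (-bj / aj - -bk / ak)
      = -(ai * ak * ((ai * bj - aj * bi) * (aj * bk - ak * bj))) / (ai ^ 2 * aj ^ 2 * ak ^ 2) := by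
    field_simp; ring
  rw [e]
  apply div_pos (by linarith) (by positivity)

/-- Shear invariance of the pairing: `β(MSMᵀ, MTMᵀ) = β(S,T)` for `M = [[1,μ],[0,1]]`
(new entries `a + 2bμ + cμ²`, `b + cμ`, `c`). [folklore] -/
theorem shear_polarDet (μ a b c a' b' c' : ℝ) :
    (a + 2 * b * μ + c * μ ^ 2) * c' + c * (a' + 2 * b' * μ + c' * μ ^ 2) - 2 * ((b + c * μ) * (b' + c' * μ))
      = a * c' + c * a' - 2 * (b * b') := by
  ring

/-- Shear invariance of `D = b² − ac`. [folklore] -/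
theorem shear_disc (μ a b c : ℝ) : (b + c * μ) ^ 2 - (a + 2 * b * μ + c * μ ^ 2) * c = b ^ 2 - a * c := by
  ring

/-- A real quadratic `a + 2bμ + cμ²` with three distinct roots is identically zero. [folklore] -/
theorem quad_coeffs_zero_of_three_roots {a b c x y z : ℝ} (hxy : x ≠ y) (hxz : x ≠ z) (hyz : y ≠ z)
    (hx : a + 2 * b * x + c * x ^ 2 = 0) (hy : a + 2 * b * y + c * y ^ 2 = 0) (hz : a + 2 * b * z + c * z ^ 2 = 0) :
    a = 0 ∧ b = 0 ∧ c = 0 := by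
  have h1 : (x - y) * (2 * b + c * (x + y)) = 0 := by linear_combination hx - hy
  have h2 : (x - z) * (2 * b + c * (x + z)) = 0 := by linear_combination hx - hz
  have h1' : 2 * b + c * (x + y) = 0 := by
    rcases mul_eq_zero.mp h1 with h | h
    · exact absurd (sub_eq_zero.mp h) hxy
    · exact h
  have h2' : 2 * b + c * (x + z) = 0 := by
    rcases mul_eq_zero.mp h2 with h | h
    · exact absurd (sub_eq_zero.mp h) hxz
    · exact h
  have hc : c * (y - z) = 0 := by linear_combination h1' - h2'
  have hc' : c = 0 := by
    rcases mul_eq_zero.mp hc with h | h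
    · exact h
    · exact absurd (sub_eq_zero.mp h) hyz
  have hb : b = 0 := by rw [hc'] at h1'; linarith
  have ha : a = 0 := by rw [hb, hc'] at hx; linarith
  exact ⟨ha, hb, hc'⟩

/-- **A common good shear exists**: for six letters with `b² − ac ≠ 0` (e.g. indefinite), some `μ ∈ {0,…,12}` makes all
six sheared leading coefficients `a + 2bμ + cμ²` non-zero (each letter kills at most two values of `μ`). [folklore] -/
theorem exists_good_shear (a b c : Fin 6 → ℝ) (hD : ∀ l, b l ^ 2 - a l * c l ≠ 0) :
    ∃ μ : ℝ, ∀ l, a l + 2 * b l * μ + c l * μ ^ 2 ≠ 0 := by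
  by_contra hne
  push Not at hne
  -- for every μ some letter vanishes; choose one for μ = 0, …, 12
  have hch : ∀ n : Fin 13, ∃ l : Fin 6, a l + 2 * b l * (n : ℝ) + c l * (n : ℝ) ^ 2 = 0 := fun n => hne n
  choose f hf using hch
  -- pigeonhole: some letter is chosen for three distinct n
  have hmaps : ∀ n ∈ (Finset.univ : Finset (Fin 13)), f n ∈ (Finset.univ : Finset (Fin 6)) := fun n _ => mem_univ _
  have hcard : (Finset.univ : Finset (Fin 6)).card * 2 < (Finset.univ : Finset (Fin 13)).card := by simp
  obtain ⟨l, -, hl⟩ := Finset.exists_lt_card_fiber_of_mul_lt_card_of_maps_to hmaps hcard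
  rw [Finset.two_lt_card] at hl
  obtain ⟨x, hx, y, hy, z, hz, hxy, hxz, hyz⟩ := hl
  simp only [mem_filter, mem_univ, true_and] at hx hy hz
  have ex := hf x
  have ey := hf y
  have ez := hf z
  rw [hx] at ex
  rw [hy] at ey
  rw [hz] at ez
  have hxy' : ((x : ℕ) : ℝ) ≠ ((y : ℕ) : ℝ) := by
    intro h; exact hxy (Fin.ext (by exact_mod_cast h))
  have hxz' : ((x : ℕ) : ℝ) ≠ ((z : ℕ) : ℝ) := by
    intro h; exact hxz (Fin.ext (by exact_mod_cast h))
  have hyz' : ((y : ℕ) : ℝ) ≠ ((z : ℕ) : ℝ) := by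
    intro h; exact hyz (Fin.ext (by exact_mod_cast h))
  obtain ⟨ha, hb, hc⟩ := quad_coeffs_zero_of_three_roots hxy' hxz' hyz' ex ey ez
  exact hD l (by rw [ha, hb, hc]; ring)

end Summit.ValiantsHypothesis.ValiantsHypothesis.Theorems.LacunarySymmetroidMatrixDescartes.Census
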